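import Literature.AlgebraicGeometry.Frobenioids.ArchimedeanBoundaryTorsor
import HarnessLib

/-!
# Frobenioids II, Remark 3.6.1 — PROVED for `C = C^ℤ`: the orbit maps `S¹ ≅ O^×(A) → ∂A_A` are
# topological embeddings onto the boundary

Mochizuki, *The geometry of Frobenioids II*, Kyushu J. Math. **62** (2008) 401–460, §3, Remark 3.6.1,
author's kurims text p. 39 [cite: MochizukiFrdII2008, Rmk 3.6.1 p.39]: "the topology of `O^×(A)` (`≅ S¹`),
for complex isotropic `A ∈ Ob(C)`, may be recovered from the category-theoretic structure of `C` [cf.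
Theorem 3.6, (vii)] …". DISCHARGE of the typed reading `ArchFrd.Rmk361` (`ArchimedeanBasicProperties.lean`)
at the archimedean Frobenioid `C π` (instance `Rmk361_C` of `ArchimedeanTheoremsInstances.lean`): with
the group isomorphism `S¹ ≅ O^×(A)`, `z ↦ ((id, 1, z), id)` (`circleEquivUnits`,
`ArchimedeanUnitCircle.lean`), the orbit map of a boundary point `x₀` is `z ↦ z · x₀ : S¹ → ℂ^×`, a
topological embedding (continuous and injective on the compact `S¹`) with image the boundary circle
`∂A_A = {|u| = tip}`. No statement of the paper is strengthened.
-/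

namespace Literature.AlgebraicGeometry.Frobenioids

open CategoryTheory Topology

universe v u

namespace ArchFrd

variable {D : Type u} [Category.{v} D] (π : D ⥤ D0)

/-- The orbit map `z ↦ z · x₀ : S¹ → ℂ^×` is continuous. [cite: MochizukiFrdII2008, Rmk 3.6.1 p.39] -/
theorem continuous_circle_mul (x₀ : ℂˣ) :
    Continuous (fun z : Circle => Circle.toUnits z * x₀) := by
  have h1 : Continuous (Circle.toUnits : Circle → ℂˣ) := by
    refine Units.continuous_iff.mpr ⟨?_, ?_⟩
    · change Continuous (fun z : Circle => ((Circle.toUnits z : ℂˣ) : ℂ))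
      simp only [Circle.toUnits_apply, Units.val_mk0]
      exact continuous_subtype_val
    · change Continuous (fun z : Circle => (((Circle.toUnits z)⁻¹ : ℂˣ) : ℂ))
      simp only [Units.val_inv_eq_inv_val, Circle.toUnits_apply, Units.val_mk0]
      exact continuous_subtype_val.inv₀ (fun z => Circle.coe_ne_zero z)
  exact h1.mul continuous_const

/-- The orbit map is injective. [cite: MochizukiFrdII2008, Rmk 3.6.1 p.39] -/
theorem circle_mul_injective (x₀ : ℂˣ) :
    Function.Injective (fun z : Circle => Circle.toUnits z * x₀) := by
  intro z w h
  have h' : Circle.toUnits z = Circle.toUnits w := mul_right_cancel h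
  exact Circle.ext (by
    have := congrArg (fun c : ℂˣ => (c : ℂ)) h'
    simpa [Circle.toUnits_apply] using this)

/-- The image of the orbit map of a boundary point is the boundary (for a naively isotropic object).
[cite: MochizukiFrdII2008, Rmk 3.6.1 p.39] -/
theorem range_circle_mul {A : AngularRegion ℂ} (hA : A.IsIsotropic) {x₀ : ℂˣ} (hx₀ : x₀ ∈ A.boundary) :
    Set.range (fun z : Circle => Circle.toUnits z * x₀) = A.boundary := by
  have hxn : ‖(x₀ : ℂ)‖ = A.tip := norm_eq_tip_of_mem_boundary hx₀
  ext y
  constructor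
  · rintro ⟨z, rfl⟩
    have hn : ‖(((Circle.toUnits z * x₀ : ℂˣ)) : ℂ)‖ = A.tip := by
      rw [Units.val_mul, norm_mul, norm_coe_circle_toUnits, one_mul, hxn]
    have habs : absHom ℂ (Circle.toUnits z * x₀) = A.tip :=
      Subtype.ext (by rw [coe_absHom]; exact hn)
    refine ⟨?_, habs⟩
    rw [C0.mem_carrier_of_isIsotropic hA, habs]
  · intro hy
    have hyn : ‖(y : ℂ)‖ = A.tip := norm_eq_tip_of_mem_boundary hy
    have hn : ‖((y * x₀⁻¹ : ℂˣ) : ℂ)‖ = 1 := by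
      rw [Units.val_mul, Units.val_inv_eq_inv_val, norm_mul, norm_inv, hxn, hyn,
        mul_inv_cancel₀ A.tip.2.ne']
    refine ⟨⟨((y * x₀⁻¹ : ℂˣ) : ℂ), mem_sphere_zero_iff_norm.mpr hn⟩, ?_⟩
    change Circle.toUnits _ * x₀ = y
    have : Circle.toUnits ⟨((y * x₀⁻¹ : ℂˣ) : ℂ), mem_sphere_zero_iff_norm.mpr hn⟩ = y * x₀⁻¹ :=
      Units.ext (by rw [Circle.toUnits_apply, Units.val_mk0])
    rw [this, inv_mul_cancel_right]

/-- **Remark 3.6.1 for `C = C^ℤ`** (PROVED, over any base): for a complex isotropic `A` and `x₀ ∈ ∂A_A`,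
under `S¹ ≅ O^×(A)` the orbit map `z ↦ z · x₀` is a topological embedding `S¹ → ℂ^×` with image `∂A_A`.
[cite: MochizukiFrdII2008, Rmk 3.6.1 p.39] -/
theorem rmk361_C : Rmk361_C π := by
  intro _ A hAc hAi x₀ hx₀
  have hA : A.fst.IsNaivelyIsotropic := isNaivelyIsotropic_fst_of_isIsotropic π A hAi
  have hπ : (π.obj A.snd).IsComplex := (D0.isComplex_toArchBase_iff _).mp hAc
  have hc : A.fst.IsComplexObj := D0.isComplex_of_hom A.iso.hom hπ
  refine ⟨(circleEquivUnits π A hA hc).symm, ?_⟩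
  have hfun : (fun z : Circle => vMap π
      (((circleEquivUnits π A hA hc).symm.symm z : PreFrobenioid.unitsSubgroup (C.toElem π) A) :
        Aut A).hom x₀) = fun z : Circle => Circle.toUnits z * x₀ := by
    funext z
    rw [MulEquiv.symm_symm, circleEquivUnits_apply,
      vMap_of_mem_unitsSubgroup π A _ (unitAutOver_mem π A hA hc _ _)]
    rfl
  rw [hfun]
  exact ⟨(continuous_circle_mul x₀).isClosedEmbedding (circle_mul_injective x₀) |>.isEmbedding,
    range_circle_mul hA hx₀⟩

end ArchFrd

end Literature.AlgebraicGeometry.Frobenioids
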